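import Literature.NumberTheory.EllipticCurves.Kato2004.EulerSystemBoundFineSelmerTwo
import HarnessLib

/-!
# Route `ThetaPartnerAtTwo` (TP2), crux K3 `SignedKatoDivisibilityUpToAtTwo` (stmt-BirchSwinnertonDyer-20308 / K3P′ 25631), line `colemanrat`
# v14.1 — Λ-FREE TWINS III: (C1) Euler system + (C2) unramified away from `2` ⟹ the Λ-adic lift of the `2`-power line is a GENUINE `2`-adic
# Euler-system class (`Kato2004.IsEulerSystemClassTwo`) with `proj_n = Cor z_{n+2,∅}` — no values, no dual-exponential datum `Λ`

Width seat `bsd-wall-tp2-p2x-w2` g8 (cell `bsd-wall`).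

* `KatoBK.exists_isEulerSystemClassTwo_of_isEulerSystem` — twin of `Kato2004.exists_isEulerSystemClassTwo_of_zetaBody`
  (`Literature/…/Kato2004/EulerSystemBoundFineSelmerTwo.lean`) with the `ZetaBody` witness replaced by its conjuncts (C1), (C2): the input
  `IsEulerSystemClassTwo W hκ I s ∧ ∀ n, I.proj n s = levelToLayerTwo … (z (n+2) idealOne)` of the socket and of the registered stub
  `stub_katoBoundTwoContra` (Kato Thm. 13.4 (2) at `2`).

AUDIT behind this file (of w3 g8's socket `KatoBK.corePairChiPrim_of_coreKZ_of_bricks`, p636266 = the lead's p635470 re-cut): of the six conjuncts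
of `Kato2004.ZetaBody W 2 f ιC κK ΛK c d a A z x` the socket consumes (C1) and (C2) (through `Kato2004.exists_isEulerSystemClassTwo_of_zetaBody`)
and (C5) (through `KatoConst.exists_ratCast_eq_katoConstant_of_analyticRank_eq_zero` — whose call of `zetaBody_value_level_one` DISCARDS the
`Λ`-clause —, `KatoBK.charSumF_mul_gaussSum_eq_two` = w4 g0's `KatoValue.charSumF_mul_gaussSum_eq`, and brick B4c = w4 g0's
`KatoValue.sum_sigma_eq_of_zetaBody`), never (C3a) (`Λ` Galois-equivariant), (C3b) (`Λ` local at `p`) or (C4) (`Λ(z) = 1 ⊗ x`). So Kato's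
ABSTRACT dual-exponential datum `Λ` — whose axioms (C3a)/(C3b) are READINGS of Kato §9.4 carried «with their own attribution» inside the fact
shape (module docstring of `Literature/…/Kato2004/EulerSystemValues.lean`, O1 / X1-eq / X1-loc) — is IDLE in the displayed residue CORE_KZ once
the Bloch–Kato clause (KZ) ties `x` to `z` through the layer pairing. The three files `…KatoBKLambdaFree{Values,CharValues,ESClass}.lean`
supply the Λ-free inputs of a re-cut socket over CORE_KZ⁰ (= CORE_KZ with «∃ ΛK … ZetaBody … ∧ (KZ)» replaced by «(C1) ∧ (C2) ∧ (C5) ∧ (KZ)»).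
The displayed hypothesis `hC5` is VERBATIM conjunct (C5) of `ZetaBody` with its `let` expanded (definitional check:
`KatoValue.valueLaw_of_zetaBody` in `…LambdaFreeCharValues`). Proofs are the originals' proofs with the destructuring of `hbody` removed.
HONEST FRAMING: theorems only (no definition, no named fact, no instance, no `sorry`); every statement is CONDITIONAL on displayed Kato-shaped
hypotheses (conjuncts of the conclusion of the cite-only fact `Kato2004.exists_eulerSystem_expStar_values`); closes no item; K3 / K3P′ are
NOT settled and BSD is NOT proved by any of this.

References: K. Kato, Astérisque 295 (2004), Ex. 13.3 (p. 225), (8.1.3) (p. 180), Lemma 8.5 (pp. 183–184), §6.2 (p. 161), Thm. 6.6 (1)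
(p. 163), Thm. 9.7 (p. 189), §13.1 and Thm. 13.4 (pp. 224–226) [Kato2004Asterisque]; B. Mazur, J. Tate, J. Teitelbaum, Invent. Math. 84
(1986) §I.8 [MazurTateTeitelbaum1986Invent]; L. Washington, *Introduction to Cyclotomic Fields* (1997) §13.1 [Washington1997].
-/

set_option autoImplicit false
-- the Theorems namespace of this sub repeats the summit name by design (D-0017 nested layout)
set_option linter.dupNamespace false

noncomputable section

set_option backward.isDefEq.respectTransparency false

open scoped NumberField TensorProduct

open Field IsDedekindDomain
  Literature.NumberTheory.GaloisRepresentations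
  Literature.NumberTheory.EllipticCurves Literature.NumberTheory.EllipticCurves.ModularForms
  Literature.NumberTheory.EllipticCurves.Kato2004 Literature.NumberTheory.EllipticCurves.Kato2004.EulerSystemValues
  Rat.HeightOneSpectrum

namespace Summit.BirchSwinnertonDyer.BirchSwinnertonDyer.Theorems.SignedKatoOffTwo.KatoBK

/-! ## §1 (C1) + (C2) ⟹ a genuine `2`-adic Euler-system class (no values, no `Λ`) -/

/-- **The Λ-adic lift of the `2`-power line of Kato's family is a genuine `2`-adic Euler-system class — from (C1) and (C2) ALONE.** Let `z` be an
Euler system for `T₂W` over the cyclotomic levels away from `prime(2cdAN)` ((C1), Kato Ex. 13.3 / Prop. 8.12) all of whose classes are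
unramified away from `2` at class level ((C2), (8.1.3) with Lemma 8.5 — which IS membership in the tree's `integralH1`), `2cdAN ≠ 0`. Then for
every pinned `I : IwasawaH1Data W 2 κ γ` there is `y ∈ 𝐇¹_Γ(T₂W)` with `IsEulerSystemClassTwo W hκ I y` and `proj_n y = Cor_{ℚ(μ_{2^{n+2}})/ℚ_n}
z_{n+2,∅}` for all `n`. Twin of `Kato2004.exists_isEulerSystemClassTwo_of_zetaBody` with the `ZetaBody` witness replaced by its conjuncts (C1),
(C2); proof = `IwasawaH1Data.existsUnique_lift_of_isEulerSystem_of_integral_two` (integrality of the corestricted class by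
`coresLe_mem_integralH1`, as in `existsUnique_lift_of_zetaBody_two`) + `isEulerSystemClassTwo_of_proj_eq_levelToLayerTwo`.
[cite: Kato2004Asterisque, Ex. 13.3 (p. 225), (8.1.3) and Lemma 8.5 (pp. 180–184), §13.1 and Thm. 13.4 (pp. 224–226)] [cite: Washington1997, §13.1] -/
theorem exists_isEulerSystemClassTwo_of_isEulerSystem (W : WeierstrassCurve ℚ) [W.IsElliptic]
    [ContinuousSMul ℤ_[2] (W.tateModule 2)] [Module.Free ℤ_[2] (W.tateModule 2)] [Module.Finite ℤ_[2] (W.tateModule 2)]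
    {κ : ZpExtension ℚ 2} (hκ : κ.IsCyclotomic) {γ : absoluteGaloisGroup ℚ} (I : Kato2004.IwasawaH1Data W 2 κ γ)
    {c d : ℤ} {A N : ℕ}
    {z : ∀ (k : ℕ) (r : (cyclotomicLevelsRat 2 (badPlaces c d A N)).Ideals),
      H1 (tateRep W 2) ((cyclotomicLevelsRat 2 (badPlaces c d A N)).level k r.1)}
    (hC1 : IsEulerSystem (cyclotomicLevelsRat 2 (badPlaces c d A N)) (tateRep W 2) 2 z)
    (hC2 : ∀ (k : ℕ) (r : (cyclotomicLevelsRat 2 (badPlaces c d A N)).Ideals) (v : HeightOneSpectrum (𝓞 ℚ)),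
      ((primesEquiv v : Nat.Primes) : ℕ) ≠ 2 →
      ∀ 𝔓 ∈ v.primesAbove,
        resLe (tateRep W 2).toTopRep
            (inf_le_left : (cyclotomicLevelsRat 2 (badPlaces c d A N)).level k r.1 ⊓ 𝔓.inertia (absoluteGaloisGroup ℚ) ≤
              (cyclotomicLevelsRat 2 (badPlaces c d A N)).level k r.1)
            1 (z k r) = 0)
    (hne : 2 * c.natAbs * d.natAbs * A * N ≠ 0) :
    ∃ y : I.H, Kato2004.IsEulerSystemClassTwo W hκ I y ∧
      ∀ n : ℕ, I.proj n y = Kato2004.levelToLayerTwo W hκ (badPlaces c d A N) n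
        (z (n + 2) (cyclotomicLevelsRat 2 (badPlaces c d A N)).idealOne) := by
  have hint : ∀ (k : ℕ) (r : (cyclotomicLevelsRat 2 (badPlaces c d A N)).Ideals),
      z k r ∈ integralH1 (tateRep W 2) 2 ((cyclotomicLevelsRat 2 (badPlaces c d A N)).level k r.1) :=
    fun k r v hv 𝔓 h𝔓 ↦ hC2 k r v hv 𝔓 h𝔓
  have hlayer : ∀ n : ℕ, Kato2004.levelToLayerTwo W hκ (badPlaces c d A N) n
      (z (n + 2) (cyclotomicLevelsRat 2 (badPlaces c d A N)).idealOne) ∈ integralH1 (tateRep W 2) 2 (κ.layerSubgroup n) := by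
    intro n
    haveI : ((cyclotomicLevelsRat 2 (badPlaces c d A N)).level (n + 2) ∅).Normal :=
      Kato2004.normal_cyclotomicLevelsRat_level_empty 2 (badPlaces c d A N) (n + 2)
    haveI : ((cyclotomicLevelsRat 2 (badPlaces c d A N)).level (n + 2) ∅).FiniteIndex :=
      finiteIndex_of_isOpen_of_compactSpace _
        ((cyclotomicLevelsRat 2 (badPlaces c d A N)).isOpen_level (n + 2) ∅)
    haveI : Fintype (κ.layerSubgroup n ⧸
        ((cyclotomicLevelsRat 2 (badPlaces c d A N)).level (n + 2) ∅).subgroupOf (κ.layerSubgroup n)) :=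
      Fintype.ofFinite _
    have key := Kato2004.coresLe_mem_integralH1 (tateRep W 2) 2
      (hκ.cyclotomicLevelsRat_level_le_layerSubgroup_two (badPlaces c d A N) n)
      ((cyclotomicLevelsRat 2 (badPlaces c d A N)).isOpen_level (n + 2) ∅)
      (fun v hv ↦ Kato2004.cyclotomicLevelsRat_level_empty_unramifiedAt 2 (badPlaces c d A N) (n + 2) v hv)
      (hint (n + 2) (cyclotomicLevelsRat 2 (badPlaces c d A N)).idealOne)
    unfold Kato2004.levelToLayerTwo
    convert key using 4
  obtain ⟨y, hy, -⟩ := Kato2004.IwasawaH1Data.existsUnique_lift_of_isEulerSystem_of_integral_two W hκ I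
    (badPlaces c d A N) z hC1 hlayer
  exact ⟨y, Kato2004.isEulerSystemClassTwo_of_proj_eq_levelToLayerTwo W hκ I (Kato2004.badPlaces_finite hne) hC1 hint hy, hy⟩

end Summit.BirchSwinnertonDyer.BirchSwinnertonDyer.Theorems.SignedKatoOffTwo.KatoBK

end
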